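import Summits.CriticalPhenomena.PercolationContinuityZ3.Theorems.PercNearOneGluingNoHeavyPcintBSMRZ5RCert
import HarnessLib

/-!
# PCINT lane, PHASE 9 (block renewal with reach-3 pieces): kernel check 2/6 of the certificate inequalities for `ℤ^5` at the cell `0.1790`

Cell `prim-pcint`, seat `prim-pcint-1` (gen 17); memo `run/shared/lean/prim/pcint/T-FIBRE-ROUTE.md` §PHASE 9.
Instance `Z5R`: `d = 5 = 3 + 2` (`k = 3` time axes, the transverse plane), bond percolation, reach-3 pieces,
7-point law `A/DA = [5, 25, 130, 680, 130, 25, 5]/1000`, horizon `N = 150` (window half-width `60`), Fourier tail (cut-off data,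
`θ₀ = 1/2`) `T = 1045257412/10^12`, cell `p = 1790/10^4`. `certFastM y ≤ φ y · (P^E k DW² DG)`
at orbit representatives `y` of the reward box (natural arithmetic; bit-mask functional `BSMR.certFastM`).
-/

namespace Summit.CriticalPhenomena.PercolationContinuityZ3.Theorems.Pcint.BSMR.Z5R

open Summit.CriticalPhenomena.PercolationContinuityZ3.Theorems.Pcint.BSMR Summit.CriticalPhenomena.PercolationContinuityZ3.Theorems.Pcint.BSMX Summit.CriticalPhenomena.PercolationContinuityZ3.Theorems.Pcint.BSM

set_option maxHeartbeats 0 in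
set_option maxRecDepth 65536 in
/-- The certificate inequalities on the offsets `((reps6.drop 5).take 5)` (cell `0.1790`). -/
theorem hrep_2 : ∀ y ∈ ((reps6.drop 5).take 5), certFastM RS 3 10000 1790 7 V0t V1t (tr2 y) (shOf (tr2 y)) (eoff (tr2 y)) ≤ Φn y * (1790 ^ 7 * 3 * 60000000 ^ 2 * (1000000000000 * 1)) := by
  decide +kernel

end Summit.CriticalPhenomena.PercolationContinuityZ3.Theorems.Pcint.BSMR.Z5R
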